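import Mathlib
import Summits.NavierStokesRegularity.NavierStokesRegularity.Theorems.WakeRatchetTailRatchetScalarFrontRetention
import Summits.NavierStokesRegularity.NavierStokesRegularity.Theorems.WakeRatchetTailRatchetScalarFrontNoSlow
import Summits.NavierStokesRegularity.NavierStokesRegularity.Theorems.WakeRatchetTailRatchetDyadicRung
import HarnessLib

/-!
# `WakeRatchet.TailRatchet` (stmt-NavierStokesRegularity-21808): the TRUE FORM of the DSS rung on the dyadic
# member — the tail ratchet holds along every admissible shell-self-similar eternal solution with the
# ACTION-DEPENDENT fraction `w = (1 − Λ⁻¹)·e^{−M/Λ}/4`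

Support file for the crux `TailRatchet` (route `WakeRatchet`; MODEL lattice ODEs of Tao 2016 §1.2, §4 —
nothing here concerns the Navier–Stokes equations; no item is closed).  The registered plan-only rung
`stub_rung_dss` of `Cruxes/TailRatchet/Lines/birth.lean` asks, for every uniformly bounded admissible inviscid
eternal solution `W` of an E₂(R) table with `W_{n+1}(σ) = W_n(σ − T)`, that the tail energies contract by a
fraction `w > 0` per shell UNIFORMLY in `ε₀ ≤ ε_s` — on the dyadic member this is exactly `¬ DyadicScalarFronts`
(`WakeRatchetDyadicRung.dyadicRung_iff_not_DyadicScalarFronts`) and is believed false.  What IS true on that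
stratum, by the retention floor of `WakeRatchetScalarFrontRetention` read through the inverse dictionary
`WakeRatchetDyadicWaveStrict`:

* `action_integral_eq` / `action_integral_le` — the scalar action `∫_{t<0} a` of the front of a single-profile
  DSS wave of `dyadicTable` equals `∫ (Φ 0 x)_0 dx ≤ ∫ ‖Φ 0 x‖ dx` (the per-shell action of the eternal
  solution, `IsEternal.action`);
* `dssMu_le_of_action` — every non-trivial admissible single-profile DSS wave of the dyadic member with
  `∫‖Φ 0 x‖dx ≤ M` has `dssMu ε₀ T ≤ 1 − (1 − Λ⁻¹)·e^{−M/Λ}/4`;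
* `dyadicRung_of_action` — **the rung's conclusion with `w = (1 − Λ⁻¹)e^{−M/Λ}/4`**: for every (`T > 0`)
  shell-self-similar admissible inviscid eternal solution `W` of `dyadicTable` whose shell-`0` action is `≤ M`,
  every tail bound `Σ_k E_{n+k}(σ) ≤ M'` (all `σ`) improves to `Σ_k E_{n+1+k}(σ) ≤ (1 − w)·M'` (all `σ`).
  The fraction degenerates like `(5/2)ε₀·e^{−M/Λ}` as `ε₀ → 0` / `M → ∞` — the uniformity the rung (and the
  crux) demanded is exactly what the kit fronts deny (`1 − μ ≈ (5/3)ε₀`), but per `(ε₀, M)` the ratchet holds.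

HONEST FRAMING: statements about a MODEL lattice ODE; the rung / crux are neither proved nor refuted here;
nothing about Navier–Stokes.
-/

noncomputable section

set_option linter.dupNamespace false

namespace Summit.NavierStokesRegularity.NavierStokesRegularity.Theorems

namespace WakeRatchetDSSRungOfAction

open Filter Topology Set MeasureTheory
open Literature.Analysis.FluidPDE Literature.Analysis.FluidPDE.TaoCascade
open WakeRatchetDyadicFront WakeRatchetDyadicWaveStrict WakeRatchetDyadicRung WakeRatchetDSS
open WakeRatchetScalarFrontRetention

variable {ε₀ T : ℝ}

/-- **The scalar action is the profile integral**: for a single-profile DSS wave of the dyadic member,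
`∫_{t<0} e^{x}(Φ 0 x)_0 dt = ∫_ℝ (Φ 0 x)_0 dx` (`x = −log(−t)`, change of variables `t = −e^{−x}`).
[cite: Tao2016AveragedNS, §4 Lemma 4.1 (4.8), §6.4; elementary] -/
theorem action_integral_eq (Φ : Fin 1 → ℝ → Em 4) :
    ∫ t in Iio 0, Real.exp (-Real.log (-t)) * Φ 0 (-Real.log (-t)) 0 = ∫ x, Φ 0 x 0 := by
  have hderiv : ∀ x ∈ (univ : Set ℝ), HasDerivWithinAt (fun x : ℝ => -Real.exp (-x))
      (Real.exp (-x)) univ x := by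
    intro x _
    have h1 : HasDerivAt (fun y : ℝ => -Real.exp (-y)) (-(Real.exp (-x) * (-1))) x :=
      ((Real.hasDerivAt_exp (-x)).comp x ((hasDerivAt_id x).neg)).neg
    exact (h1.congr_deriv (by ring)).hasDerivWithinAt
  have hinj : InjOn (fun x : ℝ => -Real.exp (-x)) univ := by
    intro x _ y _ hxy
    have : Real.exp (-x) = Real.exp (-y) := neg_injective hxy
    have := Real.exp_injective this
    linarith
  have key := integral_image_eq_integral_abs_deriv_smul MeasurableSet.univ hderiv hinj
    (fun t => Real.exp (-Real.log (-t)) * Φ 0 (-Real.log (-t)) 0)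
  rw [image_neg_exp_neg] at key
  rw [key, setIntegral_univ]
  refine integral_congr_ae (Eventually.of_forall fun x => ?_)
  simp only [neg_neg, Real.log_exp, smul_eq_mul, abs_of_pos (Real.exp_pos _)]
  rw [Real.exp_neg, ← mul_assoc, inv_mul_cancel₀ (Real.exp_pos _).ne', one_mul]

/-- **Scalar action ≤ per-shell action**: `∫_{t<0} a ≤ ∫_ℝ ‖Φ 0 x‖ dx` for the front `a` of an admissible
single-profile DSS wave of the dyadic member. [cite: Tao2016AveragedNS, §4; elementary] -/
theorem action_integral_le (hε : 0 < ε₀) {Φ : Fin 1 → ℝ → Em 4}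
    (hW : IsDSSWave ε₀ dyadicTable (1 : Equiv.Perm (Fin 1)) T Φ) :
    ∫ t in Iio 0, Real.exp (-Real.log (-t)) * Φ 0 (-Real.log (-t)) 0 ≤ ∫ x, ‖Φ 0 x‖ := by
  rw [action_integral_eq]
  have hφc : Continuous (fun x => Φ 0 x 0) :=
    continuous_iff_continuousAt.2 fun x => (hasDerivAt_comp0 hW x).continuousAt
  have hφi : Integrable (fun x => Φ 0 x 0) := by
    refine Integrable.mono' hW.mass hφc.aestronglyMeasurable (Eventually.of_forall fun x => ?_)
    rw [Real.norm_eq_abs, ← norm_eq_abs hε hW x]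
    exact norm_le_sMass Φ x 0
  have heq : (fun x => ‖Φ 0 x‖) = fun x => |Φ 0 x 0| := funext fun x => norm_eq_abs hε hW x
  rw [heq]
  exact integral_mono hφi hφi.abs fun x => le_abs_self _

/-- **Energy ratio bound from the action.**  Every non-trivial admissible single-profile DSS wave of the dyadic
member with per-shell action `∫‖Φ 0 x‖dx ≤ M` has `dssMu ε₀ T ≤ 1 − (1 − Λ⁻¹)·e^{−M/Λ}/4`.
[cite: Tao2016AveragedNS, §1.2, §4 (4.1), §6.4; cell theorem] -/
theorem dssMu_le_of_action (hε : 0 < ε₀) {Φ : Fin 1 → ℝ → Em 4}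
    (hW : IsDSSWave ε₀ dyadicTable (1 : Equiv.Perm (Fin 1)) T Φ) (hne : ∃ x, Φ 0 x ≠ 0)
    {M : ℝ} (hM : ∫ x, ‖Φ 0 x‖ ≤ M) :
    dssMu ε₀ T ≤ 1 - (1 - (bigLam ε₀)⁻¹) * Real.exp (-(M / bigLam ε₀)) / 4 := by
  obtain ⟨x, hx⟩ := hne
  have hs : 1 < Real.exp T := by
    have := hW.delay_pos; rw [← Real.exp_zero]; exact Real.exp_lt_exp.2 this
  have hΛ1 : 1 < bigLam ε₀ := WakeRatchetScalarFrontNoSlow.one_lt_bigLam' hε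
  have hΛ : 0 < bigLam ε₀ := by linarith
  have h := (one_sub_dssMu_ge hε hs (fun t ht => front_hasDerivAt hε hW t ht)
    (front_integrableOn hε hW) (front_bdd hε hW) (front_ne_zero hε hW hx)).2
  rw [Real.log_exp] at h
  have hA : ∫ t in Iio 0, Real.exp (-Real.log (-t)) * Φ 0 (-Real.log (-t)) 0 ≤ M :=
    (action_integral_le hε hW).trans hM
  have hmono : Real.exp (-(M / bigLam ε₀))
      ≤ Real.exp (-((∫ t in Iio 0, Real.exp (-Real.log (-t)) * Φ 0 (-Real.log (-t)) 0) / bigLam ε₀)) := by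
    apply Real.exp_le_exp.2
    have := div_le_div_of_nonneg_right hA hΛ.le
    linarith
  have hc : 0 ≤ 1 - (bigLam ε₀)⁻¹ := by
    have : (bigLam ε₀)⁻¹ < 1 := inv_lt_one_of_one_lt₀ hΛ1
    linarith
  have : (1 - (bigLam ε₀)⁻¹) * Real.exp (-(M / bigLam ε₀)) / 4
      ≤ (1 - (bigLam ε₀)⁻¹) * Real.exp
          (-((∫ t in Iio 0, Real.exp (-Real.log (-t)) * Φ 0 (-Real.log (-t)) 0) / bigLam ε₀)) / 4 :=
    div_le_div_of_nonneg_right (mul_le_mul_of_nonneg_left hmono hc) (by norm_num)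
  linarith

/-- **The DSS rung on the dyadic member with the ACTION-DEPENDENT fraction.**  For every admissible inviscid
eternal solution `W` of `dyadicTable` that is shell-self-similar with lag `T > 0` and whose shell-`0` action is
at most `M` (`∫‖W_0(σ)‖dσ ≤ M`), the tail energies contract per shell by
`w = (1 − Λ⁻¹)·e^{−M/Λ}/4`: if `Σ_k E_{n+k}(σ) ≤ M'` for all `σ`, then `Σ_k E_{n+1+k}(σ) ≤ (1 − w)·M'` for all
`σ` — the conclusion of `stub_rung_dss` with `w = w(ε₀, M)` in place of a uniform `w`.
[cite: Tao2016AveragedNS, §1.2, §4 Lemma 4.1 (4.8)–(4.10), §6.4; cell theorem] -/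
theorem dyadicRung_of_action (hε : 0 < ε₀) {W : ℤ → ℝ → Em 4} (hT : 0 < T)
    (hE : IsEternal ε₀ dyadicTable W) (hD : ∀ (n : ℤ) (σ : ℝ), W (n + 1) σ = W n (σ - T))
    {M : ℝ} (hM : ∫ σ, ‖W 0 σ‖ ≤ M) (n : ℤ) {M' : ℝ}
    (hM' : ∀ σ : ℝ, ∑' k : ℕ, physEnergy ε₀ W (n + k) σ ≤ M') (σ : ℝ) :
    ∑' k : ℕ, physEnergy ε₀ W (n + 1 + k) σ
      ≤ (1 - (1 - (bigLam ε₀)⁻¹) * Real.exp (-(M / bigLam ε₀)) / 4) * M' := by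
  have hΛ1 : 1 < bigLam ε₀ := WakeRatchetScalarFrontNoSlow.one_lt_bigLam' hε
  by_cases hz : ∀ (k : ℤ) (τ : ℝ), W k τ = 0
  · -- the zero solution: all tails vanish
    have h0 : ∑' k : ℕ, physEnergy ε₀ W (n + 1 + k) σ = 0 := by
      simp [physEnergy, hz]
    have hM'0 : 0 ≤ M' :=
      (tsum_nonneg fun k : ℕ => physEnergy_nonneg ε₀ W (n + (k : ℤ)) σ).trans (hM' σ)
    have hw : (1 - (bigLam ε₀)⁻¹) * Real.exp (-(M / bigLam ε₀)) / 4 ≤ 1 := by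
      have h1 : (1 - (bigLam ε₀)⁻¹) ≤ 1 := by
        have : 0 < (bigLam ε₀)⁻¹ := inv_pos.2 (by linarith); linarith
      have h2 : Real.exp (-(M / bigLam ε₀)) * (1 - (bigLam ε₀)⁻¹) ≤ Real.exp (-(M / bigLam ε₀)) * 1 :=
        mul_le_mul_of_nonneg_left h1 (Real.exp_pos _).le
      have h3 : 0 ≤ 1 - (bigLam ε₀)⁻¹ := by
        have : (bigLam ε₀)⁻¹ < 1 := inv_lt_one_of_one_lt₀ hΛ1; linarith
      by_cases hM0 : M / bigLam ε₀ ≥ 0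
      · have : Real.exp (-(M / bigLam ε₀)) ≤ 1 := Real.exp_le_one_iff.2 (by linarith)
        nlinarith
      · -- if `M < 0` the action hypothesis forces `W 0 ≡ 0`-type degeneracy; the bound is still fine:
        -- here we only need `w ≤ 1`, which may fail for very negative `M`; but `M ≥ ∫‖W 0‖ ≥ 0`.
        exfalso
        have : 0 ≤ ∫ σ, ‖W 0 σ‖ := integral_nonneg fun σ => norm_nonneg _
        have hMn : 0 ≤ M := this.trans hM
        exact hM0 (div_nonneg hMn (by linarith))
    rw [h0]
    exact mul_nonneg (by linarith) hM'0
  · push Not at hz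
    obtain ⟨k, τ, hkτ⟩ := hz
    have hW := isDSSWave_of_shellSelfSimilar hT hE hD
    have hne' : ∃ x, (fun _ : Fin 1 => W 0) 0 x ≠ 0 := by
      by_contra h
      push Not at h
      exact hkτ (eq_zero_of_shell_zero hD (fun σ => h σ) k τ)
    have hμ := dssMu_le_of_action hε hW hne' (M := M) hM
    exact contraction_of_dssMu_le hε hD hμ hM' σ

end WakeRatchetDSSRungOfAction

end Summit.NavierStokesRegularity.NavierStokesRegularity.Theorems

end
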